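import Summits.HodgeConjecture.HodgeConjecture.Theorems.Ring2WeilCoverageTypeNormSignPrincipal
import Summits.HodgeConjecture.HodgeConjecture.Theorems.Ring2WeilCoverageCyclotomicSignaturesG10
import Summits.HodgeConjecture.HodgeConjecture.Theorems.Ring2WeilCoverageCyclotomicUnconditionalSqrtNegEleven
import Summits.HodgeConjecture.HodgeConjecture.Theorems.Ring2WeilCoverageCMTypeSetOddPositions
import HarnessLib

/-!
# Weil-type family coverage — THE NORM-SIGN LAW AT THE LEVELS 33, 44: on every census row `(ℚ(ζ_M), K)` the
# `ι`-compatible polarisation types `(ϖ₀)` carried by the `K`-balanced points `ℂ^Φ/Φ(ℤ[ζ_M])` are EXACTLY the real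
# generators `ϖ₀ ∈ 𝓞 ℚ(ζ_M)⁺` with `N(ϖ₀) < 0` (NO rows) resp. `N(ϖ₀) > 0` (YES rows)

research route conditional on HC_CM; not a corollary; Q11.4-sentence-2 already refuted in dim ≥ 3.

Ring 2, WEIL-TYPE FAMILY-COVERAGE CENSUS (`HOME/WEIL-FAMILY-COVERAGE.md` `## b01`, blocks b01.34–b01.41; owner ring2-b01),
part 56b of the `Ring2WeilCoverage*` series: the level files of part 55/55b (`…TypeNormSign`, `…TypeNormSignPrincipal`: for
any CM field, under THEOREM L (i)/(ii), «type `(ϖ₀)` occurs on `ℂ^Φ/D(𝔪)`» ⟺ («principal» ⟺ `N_{K⁺/ℚ}(ϖ₀) > 0`)).  At the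
levels `M ∈ {33, 44}` (`g = 10`) THEOREM L (i) (`norm_realUnits_pos_M`: every unit of `ℤ[ζ_M]⁺` has norm `+1`)
and THEOREM L (ii) (`exists_units_sign_eq_M`: every even sign pattern is a unit pattern) are hypothesis-free tree theorems
(parts 8/9/15/18/30/30′/31/48b/57), and the principal verdict of a `K`-balanced `Φ` is the residue bit `n₋(M, K) =
#{t ∈ N_K : 2t < M} (mod 2)` (part 5′ `card_inter_nodd_mod_two_eq`, THEOREM F).  Hence, for EVERY real `ϖ₀ ∈ 𝓞 K⁺ ∖ 0`
at once (no residue sign dictionary, unlike parts 48–54 which treated one generator per file):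

* NO rows (`(33, ℚ(√−11))`, `(44, ℚ(√−11))`): **type `(ϖ₀)` occurs ⟺ `N_{K⁺/ℚ}(ϖ₀) < 0`**;
* YES rows (`(33, ℚ(√−3))`, `(44, ℚ(i))`): **type `(ϖ₀)` occurs ⟺ `N_{K⁺/ℚ}(ϖ₀) > 0`**;
* every level, EVERY CM type `Φ`: `N(ϖ₀) < 0` ⇒ exactly one of «principal», «type `(ϖ₀)`»; `N(ϖ₀) > 0` ⇒ both or neither.

Since `h(ℚ(ζ_M)) = 1` at these levels [Was97 Thm. 11.1], `h(ℚ(ζ_M)⁺) = 1` and every type `𝔣₀ ⊆ 𝓞 K⁺` is principal, so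
these rows list ALL `ι`-compatible polarisation types of the `K`-balanced `ℤ[ζ_M]`-points (S-pencil remark; the kernel statements quantify over principal types `(ϖ₀)`).  The polarisation of type `(ϖ₀)` has degree `|N_{K⁺/ℚ}(ϖ₀)|`; by
b01.41 (C) (S-pencil) its hermitian discriminant class is `[−N_{K⁺/ℚ}(ϖ₀)]·[−1]^n…` — i.e. the component `(n, K, a)` with
`a ≡ |N(ϖ₀)|` on the NO rows.

Theorems:
* `exists_type_iff_norm_pos_thirtyThree_sqrt_neg_three`
* `exists_type_iff_norm_neg_thirtyThree_sqrt_neg_eleven`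
* `xor_principal_type_thirtyThree_of_norm_neg`
* `exists_type_iff_principal_thirtyThree_of_norm_pos`
* `exists_type_iff_norm_pos_fortyFour_sqrt_neg_one`
* `exists_type_iff_norm_neg_fortyFour_sqrt_neg_eleven`
* `xor_principal_type_fortyFour_of_norm_neg`
* `exists_type_iff_principal_fortyFour_of_norm_pos`

HONEST FRAMING: torus-level statements about Shimura's divisors of type `(K; Φ; 𝔣₀)` [Sh98 §14.3 Prop. 4–5] on
`ℂ^Φ/Φ(ℤ[ζ_M])` and norms of elements of `ℚ(ζ_M)⁺`; nothing here is a statement about Hodge classes, `W_K`, general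
members or HC; `HC_CM` is used nowhere.  No `def`, no named fact, no `sorry`.

References: [cite: Shimura1998, §14.3 Prop. 4–5, pp. 103–104]; [cite: Washington1997, Thm. 11.1]; census b01.41 (seat-derived).
-/

noncomputable section

open Polynomial NumberField Complex Finset
open scoped Real nonZeroDivisors

namespace Summit.HodgeConjecture.Ring2WeilCoverage.TypeNormSignLevelsG10

open Literature.AlgebraicGeometry.Motives (CMType)
open Literature.AlgebraicGeometry.HodgeTheory (IsCMTypeSet)
open Literature.AlgebraicGeometry.ComplexMultiplication.CyclotomicCMType (isCMTypeSet_residueFilter)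
open Literature.NumberTheory.ComplexMultiplication
open Summit.HodgeConjecture.Ring2WeilCoverage.TypeNormSign
open Summit.HodgeConjecture.Ring2WeilCoverage.CyclotomicDifferent (xi_ne_zero isOfType_one_xi_top)
open Summit.HodgeConjecture.Ring2WeilCoverage.CyclotomicPrincipalObstruction (complexConj_xi)
open Summit.HodgeConjecture.Ring2WeilCoverage.CMTypeSetOddPositions (card_inter_nodd_mod_two_eq)
open Summit.HodgeConjecture.Ring2WeilCoverage.CyclotomicUnconditionalSqrtNegEleven (norm_realUnits_pos_thirtyThree)
open Summit.HodgeConjecture.Ring2WeilCoverage.CyclotomicSignaturesG10 (exists_units_sign_eq_thirtyThree)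
open Summit.HodgeConjecture.Ring2WeilCoverage.CyclotomicUnconditionalSqrtNegEleven (norm_realUnits_pos_fortyFour)
open Summit.HodgeConjecture.Ring2WeilCoverage.CyclotomicSignaturesG10 (exists_units_sign_eq_fortyFour)

variable {K : Type} [Field K] [NumberField K] {ζ : K}

/-- `𝐞(t) = exp(2πi t/n) ∈ ℂ` (`ZMod.toCircle`). -/
local notation3 (prettyPrint := false) "𝐞 " t:max => ((ZMod.toCircle t : Circle) : ℂ)

/-! ### Level `33` (`g = 20`) -/

section Level33

/-- the residue set `S_Φ` read at level `33`. -/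
local notation3 (prettyPrint := false) "SΦ33[" Φ "," z "]" =>
  (Finset.univ.filter fun t : ZMod 33 => ∃ σ ∈ (Φ : CMType K).1, σ (z : K) = 𝐞 t)

open scoped Classical in
/-- **CENSUS ROW `(ℚ(ζ_33), ℚ(√−3))` — THE TYPE SPECTRUM (a YES row: an `ι`-compatible principal polarisation exists).**
For every CM type `Φ` of `ℚ(ζ_33)` balanced for `N_K = [2, 5, 8, 14, 17, 20, 23, 26, 29, 32]` (`K = ℚ(√−3)`) and EVERY real integer `ϖ₀ ∈ 𝓞 K⁺ ∖ 0`: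
`ℂ^Φ/Φ(ℤ[ζ_33])` carries a `Φ`-positive divisor of type `(K; Φ; (ϖ₀))` **iff `N_{K⁺/ℚ}(ϖ₀) > 0`** (part 55b
`exists_type_span_iff_norm_pos_of_even` + THEOREM L (i)/(ii) at `33` + `|S_Φ ∩ N_odd| ≡ n₋ = 4`); in particular NONE
of the generators of negative norm (the ramified `𝔮_p` and the surd types of parts 49–54) gives a type on this row.
research route conditional on HC_CM; not a corollary; Q11.4-sentence-2 already refuted in dim ≥ 3. [cite: Shimura1998, §14.3 Prop. 4–5, pp. 103–104] -/
theorem exists_type_iff_norm_pos_thirtyThree_sqrt_neg_three [IsCMField K] [IsCyclotomicExtension {33} ℚ K] (hζ : IsPrimitiveRoot ζ 33)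
    (Φ : CMType K) (hbal : 2 * (SΦ33[Φ, ζ] ∩ ({2, 5, 8, 14, 17, 20, 23, 26, 29, 32} : Finset (ZMod 33))).card = (SΦ33[Φ, ζ]).card)
    {ϖ₀ : 𝓞 (maximalRealSubfield K)} (hϖ0 : ϖ₀ ≠ 0) :
    (∃ ζ' : K, IsCMField.complexConj K ζ' = -ζ' ∧ (∀ φ : Φ.1, 0 < (φ.1 ζ').im) ∧
        CMTypeLattice.IsOfType (1 : (FractionalIdeal (𝓞 K)⁰ K)ˣ) ζ' (Ideal.span {ϖ₀})) ↔
      0 < Algebra.norm ℚ ((ϖ₀ : maximalRealSubfield K)) := by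
  have hg : Nat.totient 33 = 2 * (9 + 1) := by decide
  refine exists_type_span_iff_norm_pos_of_even hζ hg Φ hϖ0 (norm_realUnits_pos_thirtyThree hζ) (exists_units_sign_eq_thirtyThree hζ Φ) ?_
  have hS := isCMTypeSet_residueFilter hζ Φ
  have hNK : IsCMTypeSet 33 ({2, 5, 8, 14, 17, 20, 23, 26, 29, 32} : Finset (ZMod 33)) := by decide
  have h := card_inter_nodd_mod_two_eq (m := 33) (by norm_num) hS hNK hbal
  have hn : ((({2, 5, 8, 14, 17, 20, 23, 26, 29, 32} : Finset (ZMod 33))).filter fun t : ZMod 33 => 2 * t.val < 33).card % 2 = 0 := by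
    decide
  rw [hn] at h
  exact Nat.even_iff.mpr h

open scoped Classical in
/-- **CENSUS ROW `(ℚ(ζ_33), ℚ(√−11))` — THE TYPE SPECTRUM (a NO row: no `ι`-compatible principal polarisation).**  For
every CM type `Φ` of `ℚ(ζ_33)` balanced for `N_K = [2, 7, 8, 10, 13, 17, 19, 28, 29, 32]` (the Weil signature `(10,10)` on `K = ℚ(√−11)`) and EVERY real integer
`ϖ₀ ∈ 𝓞 K⁺ ∖ 0` (`K⁺ = ℚ(ζ_33)⁺`): the principal CM torus `ℂ^Φ/Φ(ℤ[ζ_33])` carries a `Φ`-positive divisor `X_ζ′` of type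
`(K; Φ; (ϖ₀))` — an `ι`-compatible polarisation whose `φ_X` is the `(ϖ₀)𝔬`-multiplication, of degree `|N_{K⁺/ℚ}(ϖ₀)|` —
**iff `N_{K⁺/ℚ}(ϖ₀) < 0`**.  No sign dictionary for `ϖ₀`: part 55b `exists_type_span_iff_norm_neg_of_odd` + THEOREM L (i)/(ii)
at `33` + `|S_Φ ∩ N_odd| ≡ n₋ = 5` (part 5′ `card_inter_nodd_mod_two_eq`).  The ramified type `𝔮_p` and the surd types of
parts 49–54 are the instances `N(π) = −p^{f}`.
research route conditional on HC_CM; not a corollary; Q11.4-sentence-2 already refuted in dim ≥ 3. [cite: Shimura1998, §14.3 Prop. 4–5, pp. 103–104] -/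
theorem exists_type_iff_norm_neg_thirtyThree_sqrt_neg_eleven [IsCMField K] [IsCyclotomicExtension {33} ℚ K] (hζ : IsPrimitiveRoot ζ 33)
    (Φ : CMType K) (hbal : 2 * (SΦ33[Φ, ζ] ∩ ({2, 7, 8, 10, 13, 17, 19, 28, 29, 32} : Finset (ZMod 33))).card = (SΦ33[Φ, ζ]).card)
    {ϖ₀ : 𝓞 (maximalRealSubfield K)} (hϖ0 : ϖ₀ ≠ 0) :
    (∃ ζ' : K, IsCMField.complexConj K ζ' = -ζ' ∧ (∀ φ : Φ.1, 0 < (φ.1 ζ').im) ∧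
        CMTypeLattice.IsOfType (1 : (FractionalIdeal (𝓞 K)⁰ K)ˣ) ζ' (Ideal.span {ϖ₀})) ↔
      Algebra.norm ℚ ((ϖ₀ : maximalRealSubfield K)) < 0 := by
  have hg : Nat.totient 33 = 2 * (9 + 1) := by decide
  refine exists_type_span_iff_norm_neg_of_odd hζ hg Φ hϖ0 (norm_realUnits_pos_thirtyThree hζ) (exists_units_sign_eq_thirtyThree hζ Φ) ?_
  have hS := isCMTypeSet_residueFilter hζ Φ
  have hNK : IsCMTypeSet 33 ({2, 7, 8, 10, 13, 17, 19, 28, 29, 32} : Finset (ZMod 33)) := by decide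
  have h := card_inter_nodd_mod_two_eq (m := 33) (by norm_num) hS hNK hbal
  have hn : ((({2, 7, 8, 10, 13, 17, 19, 28, 29, 32} : Finset (ZMod 33))).filter fun t : ZMod 33 => 2 * t.val < 33).card % 2 = 1 := by
    decide
  rw [hn] at h
  exact Nat.odd_iff.mpr h

/-- **DICHOTOMY AT LEVEL `33` for EVERY real generator of NEGATIVE norm**: for every one of the `2^20` CM types `Φ` of
`ℚ(ζ_33)` and every `ϖ₀ ∈ 𝓞 K⁺` with `N_{K⁺/ℚ}(ϖ₀) < 0`, the torus `ℂ^Φ/Φ(ℤ[ζ_33])` carries EITHER an `ι`-compatible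
principal polarisation OR a `Φ`-positive divisor of type `(ϖ₀)`, NEVER BOTH (part 55b `xor_principal_span_of_norm_neg` +
THEOREM L (i)/(ii) at `33`; parts 49–54's `exists_principal_xor_type_…` for all their generators at once).
research route conditional on HC_CM; not a corollary; Q11.4-sentence-2 already refuted in dim ≥ 3. [cite: Shimura1998, §14.3 Prop. 4–5, pp. 103–104] -/
theorem xor_principal_type_thirtyThree_of_norm_neg [IsCMField K] [IsCyclotomicExtension {33} ℚ K] (hζ : IsPrimitiveRoot ζ 33)
    (Φ : CMType K) {ϖ₀ : 𝓞 (maximalRealSubfield K)} (hneg : Algebra.norm ℚ ((ϖ₀ : maximalRealSubfield K)) < 0) :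
    Xor (∃ ζ' : K, IsCMField.complexConj K ζ' = -ζ' ∧ (∀ φ : Φ.1, 0 < (φ.1 ζ').im) ∧
          CMTypeLattice.IsOfType (1 : (FractionalIdeal (𝓞 K)⁰ K)ˣ) ζ' ⊤)
      (∃ ζ' : K, IsCMField.complexConj K ζ' = -ζ' ∧ (∀ φ : Φ.1, 0 < (φ.1 ζ').im) ∧
        CMTypeLattice.IsOfType (1 : (FractionalIdeal (𝓞 K)⁰ K)ˣ) ζ' (Ideal.span {ϖ₀})) := by
  have hg : Nat.totient 33 = 2 * (9 + 1) := by decide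
  exact xor_principal_span_of_norm_neg Φ 1 (complexConj_xi hζ hg) (xi_ne_zero hζ 9) (isOfType_one_xi_top hζ 9) hneg
    (norm_realUnits_pos_thirtyThree hζ) (exists_units_sign_eq_thirtyThree hζ Φ)

/-- **POSITIVE norm at level `33`**: for every CM type `Φ` of `ℚ(ζ_33)` and every `ϖ₀ ∈ 𝓞 K⁺` with `N_{K⁺/ℚ}(ϖ₀) > 0`,
type `(ϖ₀)` occurs on `ℂ^Φ/Φ(ℤ[ζ_33])` iff an `ι`-compatible principal polarisation does (part 55b
`exists_pos_isOfType_span_iff_principal_of_norm_pos` + THEOREM L (i)/(ii) at `33`).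
research route conditional on HC_CM; not a corollary; Q11.4-sentence-2 already refuted in dim ≥ 3. [cite: Shimura1998, §14.3 Prop. 4–5, pp. 103–104] -/
theorem exists_type_iff_principal_thirtyThree_of_norm_pos [IsCMField K] [IsCyclotomicExtension {33} ℚ K] (hζ : IsPrimitiveRoot ζ 33)
    (Φ : CMType K) {ϖ₀ : 𝓞 (maximalRealSubfield K)} (hpos : 0 < Algebra.norm ℚ ((ϖ₀ : maximalRealSubfield K))) :
    (∃ ζ' : K, IsCMField.complexConj K ζ' = -ζ' ∧ (∀ φ : Φ.1, 0 < (φ.1 ζ').im) ∧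
        CMTypeLattice.IsOfType (1 : (FractionalIdeal (𝓞 K)⁰ K)ˣ) ζ' (Ideal.span {ϖ₀})) ↔
      (∃ ζ' : K, IsCMField.complexConj K ζ' = -ζ' ∧ (∀ φ : Φ.1, 0 < (φ.1 ζ').im) ∧
          CMTypeLattice.IsOfType (1 : (FractionalIdeal (𝓞 K)⁰ K)ˣ) ζ' ⊤) := by
  have hg : Nat.totient 33 = 2 * (9 + 1) := by decide
  exact exists_pos_isOfType_span_iff_principal_of_norm_pos Φ 1 (complexConj_xi hζ hg) (xi_ne_zero hζ 9)
    (isOfType_one_xi_top hζ 9) hpos (norm_realUnits_pos_thirtyThree hζ) (exists_units_sign_eq_thirtyThree hζ Φ)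

end Level33

/-! ### Level `44` (`g = 20`) -/

section Level44

/-- the residue set `S_Φ` read at level `44`. -/
local notation3 (prettyPrint := false) "SΦ44[" Φ "," z "]" =>
  (Finset.univ.filter fun t : ZMod 44 => ∃ σ ∈ (Φ : CMType K).1, σ (z : K) = 𝐞 t)

open scoped Classical in
/-- **CENSUS ROW `(ℚ(ζ_44), ℚ(i))` — THE TYPE SPECTRUM (a YES row: an `ι`-compatible principal polarisation exists).**
For every CM type `Φ` of `ℚ(ζ_44)` balanced for `N_K = [3, 7, 15, 19, 23, 27, 31, 35, 39, 43]` (`K = ℚ(i)`) and EVERY real integer `ϖ₀ ∈ 𝓞 K⁺ ∖ 0`: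
`ℂ^Φ/Φ(ℤ[ζ_44])` carries a `Φ`-positive divisor of type `(K; Φ; (ϖ₀))` **iff `N_{K⁺/ℚ}(ϖ₀) > 0`** (part 55b
`exists_type_span_iff_norm_pos_of_even` + THEOREM L (i)/(ii) at `44` + `|S_Φ ∩ N_odd| ≡ n₋ = 4`); in particular NONE
of the generators of negative norm (the ramified `𝔮_p` and the surd types of parts 49–54) gives a type on this row.
research route conditional on HC_CM; not a corollary; Q11.4-sentence-2 already refuted in dim ≥ 3. [cite: Shimura1998, §14.3 Prop. 4–5, pp. 103–104] -/
theorem exists_type_iff_norm_pos_fortyFour_sqrt_neg_one [IsCMField K] [IsCyclotomicExtension {44} ℚ K] (hζ : IsPrimitiveRoot ζ 44)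
    (Φ : CMType K) (hbal : 2 * (SΦ44[Φ, ζ] ∩ ({3, 7, 15, 19, 23, 27, 31, 35, 39, 43} : Finset (ZMod 44))).card = (SΦ44[Φ, ζ]).card)
    {ϖ₀ : 𝓞 (maximalRealSubfield K)} (hϖ0 : ϖ₀ ≠ 0) :
    (∃ ζ' : K, IsCMField.complexConj K ζ' = -ζ' ∧ (∀ φ : Φ.1, 0 < (φ.1 ζ').im) ∧
        CMTypeLattice.IsOfType (1 : (FractionalIdeal (𝓞 K)⁰ K)ˣ) ζ' (Ideal.span {ϖ₀})) ↔
      0 < Algebra.norm ℚ ((ϖ₀ : maximalRealSubfield K)) := by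
  have hg : Nat.totient 44 = 2 * (9 + 1) := by decide
  refine exists_type_span_iff_norm_pos_of_even hζ hg Φ hϖ0 (norm_realUnits_pos_fortyFour hζ) (exists_units_sign_eq_fortyFour hζ Φ) ?_
  have hS := isCMTypeSet_residueFilter hζ Φ
  have hNK : IsCMTypeSet 44 ({3, 7, 15, 19, 23, 27, 31, 35, 39, 43} : Finset (ZMod 44)) := by decide
  have h := card_inter_nodd_mod_two_eq (m := 44) (by norm_num) hS hNK hbal
  have hn : ((({3, 7, 15, 19, 23, 27, 31, 35, 39, 43} : Finset (ZMod 44))).filter fun t : ZMod 44 => 2 * t.val < 44).card % 2 = 0 := by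
    decide
  rw [hn] at h
  exact Nat.even_iff.mpr h

open scoped Classical in
/-- **CENSUS ROW `(ℚ(ζ_44), ℚ(√−11))` — THE TYPE SPECTRUM (a NO row: no `ι`-compatible principal polarisation).**  For
every CM type `Φ` of `ℚ(ζ_44)` balanced for `N_K = [7, 13, 17, 19, 21, 29, 35, 39, 41, 43]` (the Weil signature `(10,10)` on `K = ℚ(√−11)`) and EVERY real integer
`ϖ₀ ∈ 𝓞 K⁺ ∖ 0` (`K⁺ = ℚ(ζ_44)⁺`): the principal CM torus `ℂ^Φ/Φ(ℤ[ζ_44])` carries a `Φ`-positive divisor `X_ζ′` of type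
`(K; Φ; (ϖ₀))` — an `ι`-compatible polarisation whose `φ_X` is the `(ϖ₀)𝔬`-multiplication, of degree `|N_{K⁺/ℚ}(ϖ₀)|` —
**iff `N_{K⁺/ℚ}(ϖ₀) < 0`**.  No sign dictionary for `ϖ₀`: part 55b `exists_type_span_iff_norm_neg_of_odd` + THEOREM L (i)/(ii)
at `44` + `|S_Φ ∩ N_odd| ≡ n₋ = 5` (part 5′ `card_inter_nodd_mod_two_eq`).  The ramified type `𝔮_p` and the surd types of
parts 49–54 are the instances `N(π) = −p^{f}`.
research route conditional on HC_CM; not a corollary; Q11.4-sentence-2 already refuted in dim ≥ 3. [cite: Shimura1998, §14.3 Prop. 4–5, pp. 103–104] -/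
theorem exists_type_iff_norm_neg_fortyFour_sqrt_neg_eleven [IsCMField K] [IsCyclotomicExtension {44} ℚ K] (hζ : IsPrimitiveRoot ζ 44)
    (Φ : CMType K) (hbal : 2 * (SΦ44[Φ, ζ] ∩ ({7, 13, 17, 19, 21, 29, 35, 39, 41, 43} : Finset (ZMod 44))).card = (SΦ44[Φ, ζ]).card)
    {ϖ₀ : 𝓞 (maximalRealSubfield K)} (hϖ0 : ϖ₀ ≠ 0) :
    (∃ ζ' : K, IsCMField.complexConj K ζ' = -ζ' ∧ (∀ φ : Φ.1, 0 < (φ.1 ζ').im) ∧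
        CMTypeLattice.IsOfType (1 : (FractionalIdeal (𝓞 K)⁰ K)ˣ) ζ' (Ideal.span {ϖ₀})) ↔
      Algebra.norm ℚ ((ϖ₀ : maximalRealSubfield K)) < 0 := by
  have hg : Nat.totient 44 = 2 * (9 + 1) := by decide
  refine exists_type_span_iff_norm_neg_of_odd hζ hg Φ hϖ0 (norm_realUnits_pos_fortyFour hζ) (exists_units_sign_eq_fortyFour hζ Φ) ?_
  have hS := isCMTypeSet_residueFilter hζ Φ
  have hNK : IsCMTypeSet 44 ({7, 13, 17, 19, 21, 29, 35, 39, 41, 43} : Finset (ZMod 44)) := by decide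
  have h := card_inter_nodd_mod_two_eq (m := 44) (by norm_num) hS hNK hbal
  have hn : ((({7, 13, 17, 19, 21, 29, 35, 39, 41, 43} : Finset (ZMod 44))).filter fun t : ZMod 44 => 2 * t.val < 44).card % 2 = 1 := by
    decide
  rw [hn] at h
  exact Nat.odd_iff.mpr h

/-- **DICHOTOMY AT LEVEL `44` for EVERY real generator of NEGATIVE norm**: for every one of the `2^20` CM types `Φ` of
`ℚ(ζ_44)` and every `ϖ₀ ∈ 𝓞 K⁺` with `N_{K⁺/ℚ}(ϖ₀) < 0`, the torus `ℂ^Φ/Φ(ℤ[ζ_44])` carries EITHER an `ι`-compatible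
principal polarisation OR a `Φ`-positive divisor of type `(ϖ₀)`, NEVER BOTH (part 55b `xor_principal_span_of_norm_neg` +
THEOREM L (i)/(ii) at `44`; parts 49–54's `exists_principal_xor_type_…` for all their generators at once).
research route conditional on HC_CM; not a corollary; Q11.4-sentence-2 already refuted in dim ≥ 3. [cite: Shimura1998, §14.3 Prop. 4–5, pp. 103–104] -/
theorem xor_principal_type_fortyFour_of_norm_neg [IsCMField K] [IsCyclotomicExtension {44} ℚ K] (hζ : IsPrimitiveRoot ζ 44)
    (Φ : CMType K) {ϖ₀ : 𝓞 (maximalRealSubfield K)} (hneg : Algebra.norm ℚ ((ϖ₀ : maximalRealSubfield K)) < 0) :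
    Xor (∃ ζ' : K, IsCMField.complexConj K ζ' = -ζ' ∧ (∀ φ : Φ.1, 0 < (φ.1 ζ').im) ∧
          CMTypeLattice.IsOfType (1 : (FractionalIdeal (𝓞 K)⁰ K)ˣ) ζ' ⊤)
      (∃ ζ' : K, IsCMField.complexConj K ζ' = -ζ' ∧ (∀ φ : Φ.1, 0 < (φ.1 ζ').im) ∧
        CMTypeLattice.IsOfType (1 : (FractionalIdeal (𝓞 K)⁰ K)ˣ) ζ' (Ideal.span {ϖ₀})) := by
  have hg : Nat.totient 44 = 2 * (9 + 1) := by decide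
  exact xor_principal_span_of_norm_neg Φ 1 (complexConj_xi hζ hg) (xi_ne_zero hζ 9) (isOfType_one_xi_top hζ 9) hneg
    (norm_realUnits_pos_fortyFour hζ) (exists_units_sign_eq_fortyFour hζ Φ)

/-- **POSITIVE norm at level `44`**: for every CM type `Φ` of `ℚ(ζ_44)` and every `ϖ₀ ∈ 𝓞 K⁺` with `N_{K⁺/ℚ}(ϖ₀) > 0`,
type `(ϖ₀)` occurs on `ℂ^Φ/Φ(ℤ[ζ_44])` iff an `ι`-compatible principal polarisation does (part 55b
`exists_pos_isOfType_span_iff_principal_of_norm_pos` + THEOREM L (i)/(ii) at `44`).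
research route conditional on HC_CM; not a corollary; Q11.4-sentence-2 already refuted in dim ≥ 3. [cite: Shimura1998, §14.3 Prop. 4–5, pp. 103–104] -/
theorem exists_type_iff_principal_fortyFour_of_norm_pos [IsCMField K] [IsCyclotomicExtension {44} ℚ K] (hζ : IsPrimitiveRoot ζ 44)
    (Φ : CMType K) {ϖ₀ : 𝓞 (maximalRealSubfield K)} (hpos : 0 < Algebra.norm ℚ ((ϖ₀ : maximalRealSubfield K))) :
    (∃ ζ' : K, IsCMField.complexConj K ζ' = -ζ' ∧ (∀ φ : Φ.1, 0 < (φ.1 ζ').im) ∧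
        CMTypeLattice.IsOfType (1 : (FractionalIdeal (𝓞 K)⁰ K)ˣ) ζ' (Ideal.span {ϖ₀})) ↔
      (∃ ζ' : K, IsCMField.complexConj K ζ' = -ζ' ∧ (∀ φ : Φ.1, 0 < (φ.1 ζ').im) ∧
          CMTypeLattice.IsOfType (1 : (FractionalIdeal (𝓞 K)⁰ K)ˣ) ζ' ⊤) := by
  have hg : Nat.totient 44 = 2 * (9 + 1) := by decide
  exact exists_pos_isOfType_span_iff_principal_of_norm_pos Φ 1 (complexConj_xi hζ hg) (xi_ne_zero hζ 9)
    (isOfType_one_xi_top hζ 9) hpos (norm_realUnits_pos_fortyFour hζ) (exists_units_sign_eq_fortyFour hζ Φ)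

end Level44

end Summit.HodgeConjecture.Ring2WeilCoverage.TypeNormSignLevelsG10

end
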